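import Summits.QuantumFields.YangMills.Theorems.BalabanUVNodesN19TargetClassWeightsAtLiveRecord
import Literature.MathematicalPhysics.QuantumFieldTheory.Balaban1983to89.Node00.TwoRunSiteKey
import Literature.MathematicalPhysics.QuantumFieldTheory.Balaban1983to89.Node00.Record13LettersOfThm1CCMW

/-!
# BalabanUVNodes ∕ N19 (NE7) — node U5's :183 road for F3's class weights AT NODE U5d's COUPLING-FREE TWO-RUN SITE KEYS (option (b) of `Node00/TwoRunSiteKey`, NO flow
# hypothesis): run A keyed by its own (2.18) sequences (keyed class = ONE term), run B keyed by «drop level 1, block down by `L`, forget admissibility» (keyed class = a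
# block-down FIBRE), EVERY LAW DISCHARGED at the ₁₃ live re-pins; under `RAgree` it is module B⁶'s `truncSeq` reading

Cell `pub-ymgap` (HUMAN RULING D-0062, Track A), R134 seat `pub-ymgap-dag-n19-d` (gen 17), strategy s2 «by-name knit»; lane = dag-lead g11 LANE WORD l.21525; trigger (t3′) =
dag-n20-d g27 OFFER-KEY `Node00/TwoRunSiteKey` (joint INTENT, pub-ymgap INBOX 2026-08-27).  Filed `--kind proof --supports stmt-QuantumFields-20544 --as helper` (K3⁷
`SpineGivenEndpointR13SepCoPH`); COUNT-NEUTRAL.  Sibling of B‴ `…N19TargetClassWeightsE1Keyed` (p562886), B⁗ `…AtLiveRecord` (p566249), B⁶ `…TruncSeq` (option (c)).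
[III] = [Balaban1988Convergent], [LF-I] = [Balaban1989LargeFieldI], [LF-II] = [Balaban1989LargeFieldII].

WHY THIS FILE.  Modules B‴ ∕ B⁗ reduced node U5d's deliverable to N19's consumer face to TWO BARE FUNCTIONS per cutoff — key maps `kA K` ∕ `kB K` of the two runs' (2.18) sequences
of record into ONE index type `ι` (class set built in-file as `univ.image (kA K) ∪ univ.image (kB K)`), every law binder being a theorem at the ₁₃ live re-pins.  dag-n20-d's
`Node00/TwoRunSiteKey` NAMES them WITHOUT a choice and WITHOUT a flow hypothesis: the coupling-free key space `SiteSeqKey F Kc` (pairs of sequences of site sets), run A's key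
`twoRunKeyA := seqKey` (forget admissibility — INJECTIVE: a keyed class of run A is ONE term), run B's key `twoRunKeyB := seqKey ∘ truncShift` (drop level 1, block down by `L` —
admissible for run B's OWN history read one level up, `rAgree_shift` is `rfl` —, then forget: a keyed class of run B is a FIBRE of the block-down truncation = node U5d's partial
summation).  B‴ ∕ B⁗'s `ι` being ONE type across the cutoffs, the keys are SIGMA-PACKED here — `ι := Σ K, SiteSeqKey F (K₀ + K)`, `kA K s := ⟨K, twoRunKeyA … s⟩`, `kB K s' :=
⟨K, twoRunKeyB … s'⟩` (as B″ packed run A's sequences) — and the run families are built `⟨K₀ + K, mA K, cA K⟩ ∕ ⟨K₀ + K + 1, mB K, cB K⟩ : B12.RunParams` (cutoff fields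
DEFINITIONALLY `K₀ + K` ∕ `K₀ + K + 1`, no transport).  THEN (§2) B⁗ §1's ★★ road reads, at every ₁₃ live re-pin carrying K0b's residuals: `hres`, `hM : 0 < θ.τ9.M`, run
bookkeeping, `0 ≤ l₀`, `0 < vol` and THE FOUR SPINE ESTIMATES over the keyed fibre sums — and §1 says what those fibre sums ARE: run A's = its (2.18) TERM weights (an un-hit key
carries `0`), run B's = the sums over the block-down fibres; UNDER option (c)'s flow hypothesis `RAgree`: `kB = kA ∘ truncSeq`, the class set IS run A's keyed index set, and run B's
keyed class over a run-A key IS the `truncSeq`-fibre of module B⁶ — (b) and (c) give THE SAME term data on run A's keys and differ exactly at keys hit by run B and missed by run A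
(run-A weight `0` there: an OBLIGATION for the bad-class ∕ shell bounds `h20` ∕ `h21`, dag-n20-d's NET line), a set `RAgree` empties.

CONTENT (theorems only; `[∀ Kc, DecidableEq (SiteSeqKey F Kc)]` as in `TwoRunSiteKey`, classical instances for equality of sequences as in B″):
* §1 FACES OF THE SIGMA-PACKED KEYS: `sigma_twoRunKeyA_injective` · `filter_sigma_twoRunKeyA_eq` · ★ `sum_filter_sigma_twoRunKeyA_eq` · `sum_filter_sigma_twoRunKeyA_eq_zero` ·
  ★ `filter_sigma_twoRunKeyB_eq_filter_truncShift`; under `RAgree`: `sigma_twoRunKeyB_eq_sigma_twoRunKeyA_truncSeq` · ★ `image_sigma_twoRunKeyA_union_eq_of_rAgree` ·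
  `filter_sigma_twoRunKeyB_keyA_eq_filter_truncSeq` · ★ `sum_filter_sigma_twoRunKeyB_keyA_eq_sum_filter_truncSeq`.
* §2 B⁗ §1's ★★ ROAD AT THESE KEYS: ★★ `matching_scheme_of_coreEdge_twoRunKeyed_liveRepin₁₃` (DISPLAYED: `hres hM`, bookkeeping, `hl₀ hvol`, `h20 h21 hlt hedge` — NO flow
  hypothesis) · `matching_datumOfRecord₁₃CoPH_liveRepin₁₃_door_of_coreEdge_twoRunKeyed` (the re-pin's own v1.7 datum, ANY proviso proof `h`) · ★★ `…_twoRunKeyed_theta13LiveOfRecord`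
  (witness of record; `hres` ∕ `hM` DISCHARGED) · `…_twoRunKeyed_theta13OfThm1CCMW` (dag-n21-c's windowed collared K0⁷ witness; `τ9_M_pos_theta13OfThm1CCMW` BY NAME).

HONEST FRAMING.  Count-neutral kernel bookkeeping: B⁗ §1 composed BY NAME with dag-n20-d's typed keys.  It proves NO estimate: NE7 ∕ NE7b ∕ NE7c are NOT PRINTED for `d = 4` and NOT
proved here (`h20` ∕ `h21` ∕ `hlt` ∕ `hedge` remain HYPOTHESES — the nodes' content); the definer's (a)∕(b)∕(c) word is not prejudged (this is (b)'s consumer; B⁶ is (c)'s; §1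
shows they commute under `RAgree`); nothing of Bałaban's is asserted; N19 ∕ N20 ∕ N21 ∕ N27 NOT discharged; no K-item closes; counts unmoved (typed 28∕28 · discharged 5∕27).  One
finite `𝕋⁴_{L^K}` programme at fixed `ε = L^{−K}` along two consecutive cutoffs; NOT ℝ⁴, NOT OS, NOT a mass gap, NOT Clay.  No `instance`, no `notation`, no `def`.
Sources (bookkeeping): [III] (2.1) p.254, (2.5) p.255, (2.18) p.257, (3.16) p.268; [LF-I] (0.2)–(0.4) p.176; [LF-II] Thm 1 + (0.1) pp.355–356; [UV3] (6) p.257; [King1986] (3.10) p.656; [RG1] (0.1) p.251.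
-/

noncomputable section

namespace Summit.QuantumFields.YangMills.BalabanUVNodes.N19TargetClassWeightsTwoRunKeyed

open MeasureTheory Literature.MathematicalPhysics.QuantumFieldTheory.Balaban1983to89 Literature.MathematicalPhysics.QuantumFieldTheory.Balaban1983to89.Node00
open scoped BigOperators Matrix.Norms.L2Operator
open T4Continuum B14.Eq218Concrete Summit.QuantumFields.BalabanUV.T4Continuum.Spine
open T4WeightBudget (RelWeightBound)
open T4IndicatorShell (ShellWeightBound)
open T4CauchySum (MatchingModConstants)
open Summit.QuantumFields.YangMills.BalabanUVNodes.N19TargetClassWeightsAtLiveRecord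
  (matching_scheme_of_coreEdge_keyedClassWeights_imageUnion_liveRepin₁₃)

variable (F : T4Family)

/-! ## §1 FACES OF THE SIGMA-PACKED TWO-RUN SITE KEYS `s ↦ ⟨K, twoRunKeyA … s⟩`, `s' ↦ ⟨K, twoRunKeyB … s'⟩` into `Σ K, SiteSeqKey F (K₀ + K)` -/

section Faces

variable (ν : Stage7Numerics) (K₀ : ℕ)

/-- **RUN A's SIGMA-PACKED KEY IS INJECTIVE** (`twoRunKeyA_injective` and `sigma_mk_injective`): a keyed class of run A is one (2.18) term. [cite: Balaban1988Convergent, (2.18) p.257 (bookkeeping)] -/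
theorem sigma_twoRunKeyA_injective (M : ℕ) (gA : ℕ → ℕ → ℝ) (K : ℕ) :
    Function.Injective (fun s : SeqOfRecord F ν M (gA K) (K₀ + K) (K₀ + K) =>
      (⟨K, twoRunKeyA F ν M (gA K) (K₀ + K) (K₀ + K) s⟩ : Σ K, SiteSeqKey F (K₀ + K))) :=
  sigma_mk_injective.comp (twoRunKeyA_injective F ν M (gA K) (K₀ + K) (K₀ + K))

/-- **UNDER `RAgree`, `kB = kA ∘ truncSeq`** for the sigma-packed keys (dag-n20-d's `twoRunKeyB_eq_twoRunKeyA_truncSeq`: option (c) factors through option (b)).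
[cite: Balaban1988Convergent, (2.5) p.255, (2.18) p.257 (bookkeeping)] -/
theorem sigma_twoRunKeyB_eq_sigma_twoRunKeyA_truncSeq {M : ℕ} (hM : 0 < M) {gA gB : ℕ → ℕ → ℝ} {K : ℕ} (hR : RAgree F ν (gA K) (gB K) (K₀ + K))
    (s' : SeqOfRecord F ν M (gB K) (K₀ + K + 1) (K₀ + K + 1)) :
    (⟨K, twoRunKeyB F ν hM (gB K) (K₀ + K) (K₀ + K) s'⟩ : Σ K, SiteSeqKey F (K₀ + K))
      = ⟨K, twoRunKeyA F ν M (gA K) (K₀ + K) (K₀ + K) (truncSeq F ν hM hR s')⟩ := by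
  rw [twoRunKeyB_eq_twoRunKeyA_truncSeq F ν hM hR s']

variable [∀ Kc, DecidableEq (SiteSeqKey F Kc)]

/-- The fibre of run A's sigma-packed key over the key of `s₀` is `{s₀}`. [cite: Balaban1988Convergent, (2.18) p.257 (bookkeeping)] -/
theorem filter_sigma_twoRunKeyA_eq (M : ℕ) (gA : ℕ → ℕ → ℝ) (K : ℕ) (s₀ : SeqOfRecord F ν M (gA K) (K₀ + K) (K₀ + K)) :
    Finset.univ.filter (fun s : SeqOfRecord F ν M (gA K) (K₀ + K) (K₀ + K) =>
        (⟨K, twoRunKeyA F ν M (gA K) (K₀ + K) (K₀ + K) s⟩ : Σ K, SiteSeqKey F (K₀ + K)) = ⟨K, twoRunKeyA F ν M (gA K) (K₀ + K) (K₀ + K) s₀⟩)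
      = {s₀} := by
  ext s
  simp only [Finset.mem_filter, Finset.mem_univ, true_and, Finset.mem_singleton, (sigma_twoRunKeyA_injective F ν K₀ M gA K).eq_iff]

/-- **★ RUN A's KEYED CLASS WEIGHT IS ITS (2.18) TERM WEIGHT**: the fibre sum of any weight `f` over run A's sigma-packed key of `s₀` is `f s₀`.
[cite: Balaban1988Convergent, (2.18) p.257 (bookkeeping)] -/
theorem sum_filter_sigma_twoRunKeyA_eq (M : ℕ) (gA : ℕ → ℕ → ℝ) (K : ℕ) {β : Type*} [AddCommMonoid β]
    (f : SeqOfRecord F ν M (gA K) (K₀ + K) (K₀ + K) → β) (s₀ : SeqOfRecord F ν M (gA K) (K₀ + K) (K₀ + K)) :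
    ∑ s ∈ Finset.univ.filter (fun s : SeqOfRecord F ν M (gA K) (K₀ + K) (K₀ + K) =>
        (⟨K, twoRunKeyA F ν M (gA K) (K₀ + K) (K₀ + K) s⟩ : Σ K, SiteSeqKey F (K₀ + K)) = ⟨K, twoRunKeyA F ν M (gA K) (K₀ + K) (K₀ + K) s₀⟩), f s
      = f s₀ := by
  rw [filter_sigma_twoRunKeyA_eq, Finset.sum_singleton]

/-- A key not hit by run A carries the run-A keyed class weight `0` (in particular every key `⟨K', ·⟩` with `K' ≠ K`, and — off `RAgree` — every run-B key without a run-A partner: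
dag-n20-d's NET line, an obligation for the bad-class ∕ shell bounds). [cite: Balaban1988Convergent, (2.18) p.257 (bookkeeping)] -/
theorem sum_filter_sigma_twoRunKeyA_eq_zero (M : ℕ) (gA : ℕ → ℕ → ℝ) (K : ℕ) {β : Type*} [AddCommMonoid β]
    (f : SeqOfRecord F ν M (gA K) (K₀ + K) (K₀ + K) → β) {x : Σ K, SiteSeqKey F (K₀ + K)}
    (hx : x ∉ Set.range (fun s : SeqOfRecord F ν M (gA K) (K₀ + K) (K₀ + K) =>
      (⟨K, twoRunKeyA F ν M (gA K) (K₀ + K) (K₀ + K) s⟩ : Σ K, SiteSeqKey F (K₀ + K)))) :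
    ∑ s ∈ Finset.univ.filter (fun s : SeqOfRecord F ν M (gA K) (K₀ + K) (K₀ + K) =>
        (⟨K, twoRunKeyA F ν M (gA K) (K₀ + K) (K₀ + K) s⟩ : Σ K, SiteSeqKey F (K₀ + K)) = x), f s = 0 :=
  Finset.sum_eq_zero fun s hs => (hx ⟨s, (Finset.mem_filter.mp hs).2⟩).elim

open Classical in
/-- **★ RUN B's KEYED CLASS IS A FIBRE OF THE BLOCK-DOWN TRUNCATION**: the fibre of run B's sigma-packed key over the key of `s'₀` is the set of run-B sequences whose flow-free
truncation («drop level 1, block down by `L`») equals that of `s'₀` — node U5d's partial summation. [cite: Balaban1988Convergent, (2.1) p.254, (2.18) p.257 (bookkeeping)] -/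
theorem filter_sigma_twoRunKeyB_eq_filter_truncShift {M : ℕ} (hM : 0 < M) (gB : ℕ → ℕ → ℝ) (K : ℕ)
    (s'₀ : SeqOfRecord F ν M (gB K) (K₀ + K + 1) (K₀ + K + 1)) :
    Finset.univ.filter (fun s' : SeqOfRecord F ν M (gB K) (K₀ + K + 1) (K₀ + K + 1) =>
        (⟨K, twoRunKeyB F ν hM (gB K) (K₀ + K) (K₀ + K) s'⟩ : Σ K, SiteSeqKey F (K₀ + K)) = ⟨K, twoRunKeyB F ν hM (gB K) (K₀ + K) (K₀ + K) s'₀⟩)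
      = Finset.univ.filter (fun s' : SeqOfRecord F ν M (gB K) (K₀ + K + 1) (K₀ + K + 1) =>
          truncShift F ν hM (gB K) s' = truncShift F ν hM (gB K) s'₀) := by
  refine Finset.filter_congr fun s' _ => ?_
  rw [sigma_mk_injective.eq_iff, twoRunKeyB_eq_iff]

/-- **★ UNDER `RAgree` THE IN-FILE CLASS SET OF B‴ ∕ B⁗ IS RUN A's KEYED INDEX SET**: `univ.image kA ∪ univ.image kB = univ.image kA` for the sigma-packed keys.
[cite: Balaban1988Convergent, (2.5) p.255, (2.18) p.257 (bookkeeping)] -/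
theorem image_sigma_twoRunKeyA_union_eq_of_rAgree {M : ℕ} (hM : 0 < M) {gA gB : ℕ → ℕ → ℝ} {K : ℕ} (hR : RAgree F ν (gA K) (gB K) (K₀ + K)) :
    Finset.univ.image (fun s : SeqOfRecord F ν M (gA K) (K₀ + K) (K₀ + K) =>
        (⟨K, twoRunKeyA F ν M (gA K) (K₀ + K) (K₀ + K) s⟩ : Σ K, SiteSeqKey F (K₀ + K)))
      ∪ Finset.univ.image (fun s' : SeqOfRecord F ν M (gB K) (K₀ + K + 1) (K₀ + K + 1) =>
        (⟨K, twoRunKeyB F ν hM (gB K) (K₀ + K) (K₀ + K) s'⟩ : Σ K, SiteSeqKey F (K₀ + K)))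
      = Finset.univ.image (fun s : SeqOfRecord F ν M (gA K) (K₀ + K) (K₀ + K) =>
        (⟨K, twoRunKeyA F ν M (gA K) (K₀ + K) (K₀ + K) s⟩ : Σ K, SiteSeqKey F (K₀ + K))) := by
  refine Finset.union_eq_left.mpr fun x hx => ?_
  obtain ⟨s', -, rfl⟩ := Finset.mem_image.mp hx
  exact Finset.mem_image.mpr ⟨truncSeq F ν hM hR s', Finset.mem_univ _, (sigma_twoRunKeyB_eq_sigma_twoRunKeyA_truncSeq F ν K₀ hM hR s').symm⟩

open Classical in
/-- **UNDER `RAgree`, RUN B's KEYED CLASS OVER A RUN-A KEY IS THE `truncSeq`-FIBRE** of module B⁶ (option (c)): the fibre of `kB` over `kA s` is `{s' : truncSeq s' = s}`.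
[cite: Balaban1988Convergent, (2.5) p.255, (2.18) p.257 (bookkeeping)] -/
theorem filter_sigma_twoRunKeyB_keyA_eq_filter_truncSeq {M : ℕ} (hM : 0 < M) {gA gB : ℕ → ℕ → ℝ} {K : ℕ} (hR : RAgree F ν (gA K) (gB K) (K₀ + K))
    (s : SeqOfRecord F ν M (gA K) (K₀ + K) (K₀ + K)) :
    Finset.univ.filter (fun s' : SeqOfRecord F ν M (gB K) (K₀ + K + 1) (K₀ + K + 1) =>
        (⟨K, twoRunKeyB F ν hM (gB K) (K₀ + K) (K₀ + K) s'⟩ : Σ K, SiteSeqKey F (K₀ + K)) = ⟨K, twoRunKeyA F ν M (gA K) (K₀ + K) (K₀ + K) s⟩)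
      = Finset.univ.filter (fun s' : SeqOfRecord F ν M (gB K) (K₀ + K + 1) (K₀ + K + 1) => truncSeq F ν hM hR s' = s) := by
  refine Finset.filter_congr fun s' _ => ?_
  rw [sigma_mk_injective.eq_iff, twoRunKeyB_eq_twoRunKeyA_iff F ν hM hR]

open Classical in
/-- **★ … so options (b) and (c) give THE SAME run-B term weight on every run-A key**: the fibre sum of any weight `f` over run B's sigma-packed key of `kA s` equals the sum over the
`truncSeq`-fibre of `s` (module B⁶'s `B`). [cite: Balaban1988Convergent, (2.5) p.255, (2.18) p.257 (bookkeeping)] -/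
theorem sum_filter_sigma_twoRunKeyB_keyA_eq_sum_filter_truncSeq {M : ℕ} (hM : 0 < M) {gA gB : ℕ → ℕ → ℝ} {K : ℕ} (hR : RAgree F ν (gA K) (gB K) (K₀ + K))
    {β : Type*} [AddCommMonoid β] (f : SeqOfRecord F ν M (gB K) (K₀ + K + 1) (K₀ + K + 1) → β) (s : SeqOfRecord F ν M (gA K) (K₀ + K) (K₀ + K)) :
    ∑ s' ∈ Finset.univ.filter (fun s' : SeqOfRecord F ν M (gB K) (K₀ + K + 1) (K₀ + K + 1) =>
        (⟨K, twoRunKeyB F ν hM (gB K) (K₀ + K) (K₀ + K) s'⟩ : Σ K, SiteSeqKey F (K₀ + K)) = ⟨K, twoRunKeyA F ν M (gA K) (K₀ + K) (K₀ + K) s⟩), f s'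
      = ∑ s' ∈ Finset.univ.filter (fun s' : SeqOfRecord F ν M (gB K) (K₀ + K + 1) (K₀ + K + 1) => truncSeq F ν hM hR s' = s), f s' := by
  rw [filter_sigma_twoRunKeyB_keyA_eq_filter_truncSeq F ν K₀ hM hR s]

end Faces

/-! ## §2 B⁗ §1's ★★ ROAD AT THE SIGMA-PACKED TWO-RUN SITE KEYS — every law discharged at the ₁₃ live re-pins, NO flow hypothesis -/

section Road

variable (N : ℕ) [NeZero N] [∀ Kc, DecidableEq (SiteSeqKey F Kc)]

/-- **★★ N19's :183 ROAD FOR F3's CLASS WEIGHTS AT NODE U5d's COUPLING-FREE TWO-RUN SITE KEYS, AT THE RE-PIN, EVERY LAW DISCHARGED — NO FLOW HYPOTHESIS.**  For the run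
families `K ↦ ⟨K₀ + K, mA K, cA K⟩` ∕ `K ↦ ⟨K₀ + K + 1, mB K, cB K⟩` with histories `gA K` ∕ `gB K` starting at the dressing's coupling and [I]'s basic cube size positive (`hM`):
IF N20's `RelWeightBound`, N21's `ShellWeightBound`, U4′'s `W + Wsh < 1` and N19's ∃δ-edge hold for the KEYED term data over `Σ K, SiteSeqKey F (K₀ + K)` — class set
`univ.image (kA K) ∪ univ.image (kB K)`, `A K t x = Σ_{s : kA K s = x}` run A's (2.18) term weights (= ONE term or `0`, §1), `B K t x = Σ_{s' : kB K s' = x}` run B's (2.18) term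
weights at cutoff `K₀ + K + 1` (= a block-down FIBRE sum, §1) with `kA K s = ⟨K, twoRunKeyA … s⟩`, `kB K s' = ⟨K, twoRunKeyB … s'⟩` — THEN `∃ δ′, Summable δ′ ∧
MatchingModConstants vol l₀ δ′ (schemeZ (D.scheme g₀) os)`.  Module B⁗ §1 `matching_scheme_of_coreEdge_keyedClassWeights_imageUnion_liveRepin₁₃` at these keys (cutoff equations
`rfl`).  DISPLAYED: `hres hM`, `D hD g₀ os K₀ mA mB cA cB gA gB hgA hgB`, `hl₀ hvol`, THE FOUR ESTIMATES — nothing else.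
[cite: Balaban1985UV3, (6) p.257; Balaban1989LargeFieldII, Thm 1 + (0.1) pp.355–356; Balaban1989LargeFieldI, (0.2)–(0.4) p.176; Balaban1988Convergent, (2.1) p.254, (2.18) p.257; King1986, (3.10) p.656; Balaban1987RG1, (0.1) p.251 (bookkeeping)] -/
theorem matching_scheme_of_coreEdge_twoRunKeyed_liveRepin₁₃ (θ : Stage13Params F N) (hres : θ.HasResidualsOfRecord F N) (hM : 0 < θ.τ9.M)
    (D : FiniteEpsData F (SU N)) (hD : D.AvgMeasurable) (g₀ : ℕ → ℝ) (os : List (ULoop F)) (K₀ : ℕ) (mA mB : ℕ → ℕ) (cA cB : ℕ → ℝ) (gA gB : ℕ → ℕ → ℝ)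
    (hgA : ∀ K, gA K 0 = g₀ (K₀ + K)) (hgB : ∀ K, gB K 0 = g₀ (K₀ + K + 1))
    {l₀ vol : ℝ} (hl₀ : 0 ≤ l₀) (hvol : 0 < vol) {shA shB : ℕ → ℝ → (Σ K, SiteSeqKey F (K₀ + K)) → ℝ} {Bad : ℕ → ℝ → Finset (Σ K, SiteSeqKey F (K₀ + K))}
    {W Wsh : ℕ → ℝ}
    (h20 : RelWeightBound l₀
      (fun K => Finset.univ.image (fun s : SeqOfRecord F θ.ν θ.τ9.M (gA K) (K₀ + K) (K₀ + K) =>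
          (⟨K, twoRunKeyA F θ.ν θ.τ9.M (gA K) (K₀ + K) (K₀ + K) s⟩ : Σ K, SiteSeqKey F (K₀ + K)))
        ∪ Finset.univ.image (fun s' : SeqOfRecord F θ.ν θ.τ9.M (gB K) (K₀ + K + 1) (K₀ + K + 1) =>
          (⟨K, twoRunKeyB F θ.ν hM (gB K) (K₀ + K) (K₀ + K) s'⟩ : Σ K, SiteSeqKey F (K₀ + K))))
      (fun K t x => ∑ s ∈ Finset.univ.filter (fun s : SeqOfRecord F θ.ν θ.τ9.M (gA K) (K₀ + K) (K₀ + K) =>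
          (⟨K, twoRunKeyA F θ.ν θ.τ9.M (gA K) (K₀ + K) (K₀ + K) s⟩ : Σ K, SiteSeqKey F (K₀ + K)) = x),
        classWeightOfDatum₉ F N (θ.liveRepin₁₃ F N).toStage9Params D g₀ os ⟨K₀ + K, mA K, cA K⟩ (gA K) (K₀ + K) t s)
      (fun K t x => ∑ s' ∈ Finset.univ.filter (fun s' : SeqOfRecord F θ.ν θ.τ9.M (gB K) (K₀ + K + 1) (K₀ + K + 1) =>
          (⟨K, twoRunKeyB F θ.ν hM (gB K) (K₀ + K) (K₀ + K) s'⟩ : Σ K, SiteSeqKey F (K₀ + K)) = x),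
        classWeightOfDatum₉ F N (θ.liveRepin₁₃ F N).toStage9Params D g₀ os ⟨K₀ + K + 1, mB K, cB K⟩ (gB K) (K₀ + K + 1) t s') Bad W)
    (h21 : ShellWeightBound l₀
      (fun K => Finset.univ.image (fun s : SeqOfRecord F θ.ν θ.τ9.M (gA K) (K₀ + K) (K₀ + K) =>
          (⟨K, twoRunKeyA F θ.ν θ.τ9.M (gA K) (K₀ + K) (K₀ + K) s⟩ : Σ K, SiteSeqKey F (K₀ + K)))
        ∪ Finset.univ.image (fun s' : SeqOfRecord F θ.ν θ.τ9.M (gB K) (K₀ + K + 1) (K₀ + K + 1) =>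
          (⟨K, twoRunKeyB F θ.ν hM (gB K) (K₀ + K) (K₀ + K) s'⟩ : Σ K, SiteSeqKey F (K₀ + K))))
      (fun K t x => ∑ s ∈ Finset.univ.filter (fun s : SeqOfRecord F θ.ν θ.τ9.M (gA K) (K₀ + K) (K₀ + K) =>
          (⟨K, twoRunKeyA F θ.ν θ.τ9.M (gA K) (K₀ + K) (K₀ + K) s⟩ : Σ K, SiteSeqKey F (K₀ + K)) = x),
        classWeightOfDatum₉ F N (θ.liveRepin₁₃ F N).toStage9Params D g₀ os ⟨K₀ + K, mA K, cA K⟩ (gA K) (K₀ + K) t s)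
      (fun K t x => ∑ s' ∈ Finset.univ.filter (fun s' : SeqOfRecord F θ.ν θ.τ9.M (gB K) (K₀ + K + 1) (K₀ + K + 1) =>
          (⟨K, twoRunKeyB F θ.ν hM (gB K) (K₀ + K) (K₀ + K) s'⟩ : Σ K, SiteSeqKey F (K₀ + K)) = x),
        classWeightOfDatum₉ F N (θ.liveRepin₁₃ F N).toStage9Params D g₀ os ⟨K₀ + K + 1, mB K, cB K⟩ (gB K) (K₀ + K + 1) t s') shA shB Wsh)
    (hlt : ∀ K, W K + Wsh K < 1)
    (hedge : ∃ δ : ℕ → ℝ, NE7.Core l₀ vol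
      (fun K => Finset.univ.image (fun s : SeqOfRecord F θ.ν θ.τ9.M (gA K) (K₀ + K) (K₀ + K) =>
          (⟨K, twoRunKeyA F θ.ν θ.τ9.M (gA K) (K₀ + K) (K₀ + K) s⟩ : Σ K, SiteSeqKey F (K₀ + K)))
        ∪ Finset.univ.image (fun s' : SeqOfRecord F θ.ν θ.τ9.M (gB K) (K₀ + K + 1) (K₀ + K + 1) =>
          (⟨K, twoRunKeyB F θ.ν hM (gB K) (K₀ + K) (K₀ + K) s'⟩ : Σ K, SiteSeqKey F (K₀ + K)))) Bad
      (fun K t x => (∑ s ∈ Finset.univ.filter (fun s : SeqOfRecord F θ.ν θ.τ9.M (gA K) (K₀ + K) (K₀ + K) =>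
          (⟨K, twoRunKeyA F θ.ν θ.τ9.M (gA K) (K₀ + K) (K₀ + K) s⟩ : Σ K, SiteSeqKey F (K₀ + K)) = x),
        classWeightOfDatum₉ F N (θ.liveRepin₁₃ F N).toStage9Params D g₀ os ⟨K₀ + K, mA K, cA K⟩ (gA K) (K₀ + K) t s) - shA K t x)
      (fun K t x => (∑ s' ∈ Finset.univ.filter (fun s' : SeqOfRecord F θ.ν θ.τ9.M (gB K) (K₀ + K + 1) (K₀ + K + 1) =>
          (⟨K, twoRunKeyB F θ.ν hM (gB K) (K₀ + K) (K₀ + K) s'⟩ : Σ K, SiteSeqKey F (K₀ + K)) = x),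
        classWeightOfDatum₉ F N (θ.liveRepin₁₃ F N).toStage9Params D g₀ os ⟨K₀ + K + 1, mB K, cB K⟩ (gB K) (K₀ + K + 1) t s') - shB K t x) δ ∧ Summable δ) :
    ∃ δ' : ℕ → ℝ, Summable δ' ∧ MatchingModConstants vol l₀ δ' (T4GenFunBounds.schemeZ (D.scheme g₀) os) :=
  matching_scheme_of_coreEdge_keyedClassWeights_imageUnion_liveRepin₁₃ F N θ hres D hD g₀ os (fun K => ⟨K₀ + K, mA K, cA K⟩)
    (fun K => ⟨K₀ + K + 1, mB K, cB K⟩) gA gB (fun _ => rfl) (fun _ => rfl) hgA hgB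
    (fun K s => (⟨K, twoRunKeyA F θ.ν θ.τ9.M (gA K) (K₀ + K) (K₀ + K) s⟩ : Σ K, SiteSeqKey F (K₀ + K)))
    (fun K s' => (⟨K, twoRunKeyB F θ.ν hM (gB K) (K₀ + K) (K₀ + K) s'⟩ : Σ K, SiteSeqKey F (K₀ + K))) hl₀ hvol h20 h21 hlt hedge

/-- **★ THE SAME AT THE RE-PIN'S OWN v1.7 DATUM OF RECORD** (history-blind cured door; ANY proviso proof `h`, inhabited given `hres` by
`(Stage13Params.provisos₁₃Core_liveRepin₁₃_of_hasResiduals hres).ofCured.ofHistoryBlind`); B1 `isPrintedAveraged_datumOfRecord₁₃CoPH` BY NAME.  DISPLAYED: `hres h hM`, bookkeeping,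
`hl₀ hvol`, THE FOUR ESTIMATES. [cite: Balaban1985UV3, (6) p.257; Balaban1989LargeFieldII, Thm 1 + (0.1) pp.355–356; Balaban1988Convergent, (2.18) p.257; King1986, (3.10) p.656 (bookkeeping)] -/
theorem matching_datumOfRecord₁₃CoPH_liveRepin₁₃_door_of_coreEdge_twoRunKeyed (θ : Stage13Params F N) (hres : θ.HasResidualsOfRecord F N)
    (h : (Stage13HParams.ofHistoryBlind F N (Stage13RParams.ofCured F N (θ.liveRepin₁₃ F N))).Provisos₁₃CoPH F N) (hM : 0 < θ.τ9.M)
    (g₀ : ℕ → ℝ) (os : List (ULoop F)) (K₀ : ℕ) (mA mB : ℕ → ℕ) (cA cB : ℕ → ℝ) (gA gB : ℕ → ℕ → ℝ)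
    (hgA : ∀ K, gA K 0 = g₀ (K₀ + K)) (hgB : ∀ K, gB K 0 = g₀ (K₀ + K + 1))
    {l₀ vol : ℝ} (hl₀ : 0 ≤ l₀) (hvol : 0 < vol) {shA shB : ℕ → ℝ → (Σ K, SiteSeqKey F (K₀ + K)) → ℝ} {Bad : ℕ → ℝ → Finset (Σ K, SiteSeqKey F (K₀ + K))}
    {W Wsh : ℕ → ℝ}
    (h20 : RelWeightBound l₀
      (fun K => Finset.univ.image (fun s : SeqOfRecord F θ.ν θ.τ9.M (gA K) (K₀ + K) (K₀ + K) =>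
          (⟨K, twoRunKeyA F θ.ν θ.τ9.M (gA K) (K₀ + K) (K₀ + K) s⟩ : Σ K, SiteSeqKey F (K₀ + K)))
        ∪ Finset.univ.image (fun s' : SeqOfRecord F θ.ν θ.τ9.M (gB K) (K₀ + K + 1) (K₀ + K + 1) =>
          (⟨K, twoRunKeyB F θ.ν hM (gB K) (K₀ + K) (K₀ + K) s'⟩ : Σ K, SiteSeqKey F (K₀ + K))))
      (fun K t x => ∑ s ∈ Finset.univ.filter (fun s : SeqOfRecord F θ.ν θ.τ9.M (gA K) (K₀ + K) (K₀ + K) =>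
          (⟨K, twoRunKeyA F θ.ν θ.τ9.M (gA K) (K₀ + K) (K₀ + K) s⟩ : Σ K, SiteSeqKey F (K₀ + K)) = x),
        classWeightOfDatum₉ F N (θ.liveRepin₁₃ F N).toStage9Params
          (datumOfRecord₁₃CoPH F N (Stage13HParams.ofHistoryBlind F N (Stage13RParams.ofCured F N (θ.liveRepin₁₃ F N))) h) g₀ os ⟨K₀ + K, mA K, cA K⟩ (gA K) (K₀ + K) t s)
      (fun K t x => ∑ s' ∈ Finset.univ.filter (fun s' : SeqOfRecord F θ.ν θ.τ9.M (gB K) (K₀ + K + 1) (K₀ + K + 1) =>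
          (⟨K, twoRunKeyB F θ.ν hM (gB K) (K₀ + K) (K₀ + K) s'⟩ : Σ K, SiteSeqKey F (K₀ + K)) = x),
        classWeightOfDatum₉ F N (θ.liveRepin₁₃ F N).toStage9Params
          (datumOfRecord₁₃CoPH F N (Stage13HParams.ofHistoryBlind F N (Stage13RParams.ofCured F N (θ.liveRepin₁₃ F N))) h) g₀ os ⟨K₀ + K + 1, mB K, cB K⟩ (gB K) (K₀ + K + 1) t s')
      Bad W)
    (h21 : ShellWeightBound l₀
      (fun K => Finset.univ.image (fun s : SeqOfRecord F θ.ν θ.τ9.M (gA K) (K₀ + K) (K₀ + K) =>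
          (⟨K, twoRunKeyA F θ.ν θ.τ9.M (gA K) (K₀ + K) (K₀ + K) s⟩ : Σ K, SiteSeqKey F (K₀ + K)))
        ∪ Finset.univ.image (fun s' : SeqOfRecord F θ.ν θ.τ9.M (gB K) (K₀ + K + 1) (K₀ + K + 1) =>
          (⟨K, twoRunKeyB F θ.ν hM (gB K) (K₀ + K) (K₀ + K) s'⟩ : Σ K, SiteSeqKey F (K₀ + K))))
      (fun K t x => ∑ s ∈ Finset.univ.filter (fun s : SeqOfRecord F θ.ν θ.τ9.M (gA K) (K₀ + K) (K₀ + K) =>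
          (⟨K, twoRunKeyA F θ.ν θ.τ9.M (gA K) (K₀ + K) (K₀ + K) s⟩ : Σ K, SiteSeqKey F (K₀ + K)) = x),
        classWeightOfDatum₉ F N (θ.liveRepin₁₃ F N).toStage9Params
          (datumOfRecord₁₃CoPH F N (Stage13HParams.ofHistoryBlind F N (Stage13RParams.ofCured F N (θ.liveRepin₁₃ F N))) h) g₀ os ⟨K₀ + K, mA K, cA K⟩ (gA K) (K₀ + K) t s)
      (fun K t x => ∑ s' ∈ Finset.univ.filter (fun s' : SeqOfRecord F θ.ν θ.τ9.M (gB K) (K₀ + K + 1) (K₀ + K + 1) =>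
          (⟨K, twoRunKeyB F θ.ν hM (gB K) (K₀ + K) (K₀ + K) s'⟩ : Σ K, SiteSeqKey F (K₀ + K)) = x),
        classWeightOfDatum₉ F N (θ.liveRepin₁₃ F N).toStage9Params
          (datumOfRecord₁₃CoPH F N (Stage13HParams.ofHistoryBlind F N (Stage13RParams.ofCured F N (θ.liveRepin₁₃ F N))) h) g₀ os ⟨K₀ + K + 1, mB K, cB K⟩ (gB K) (K₀ + K + 1) t s')
      shA shB Wsh)
    (hlt : ∀ K, W K + Wsh K < 1)
    (hedge : ∃ δ : ℕ → ℝ, NE7.Core l₀ vol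
      (fun K => Finset.univ.image (fun s : SeqOfRecord F θ.ν θ.τ9.M (gA K) (K₀ + K) (K₀ + K) =>
          (⟨K, twoRunKeyA F θ.ν θ.τ9.M (gA K) (K₀ + K) (K₀ + K) s⟩ : Σ K, SiteSeqKey F (K₀ + K)))
        ∪ Finset.univ.image (fun s' : SeqOfRecord F θ.ν θ.τ9.M (gB K) (K₀ + K + 1) (K₀ + K + 1) =>
          (⟨K, twoRunKeyB F θ.ν hM (gB K) (K₀ + K) (K₀ + K) s'⟩ : Σ K, SiteSeqKey F (K₀ + K)))) Bad
      (fun K t x => (∑ s ∈ Finset.univ.filter (fun s : SeqOfRecord F θ.ν θ.τ9.M (gA K) (K₀ + K) (K₀ + K) =>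
          (⟨K, twoRunKeyA F θ.ν θ.τ9.M (gA K) (K₀ + K) (K₀ + K) s⟩ : Σ K, SiteSeqKey F (K₀ + K)) = x),
        classWeightOfDatum₉ F N (θ.liveRepin₁₃ F N).toStage9Params
          (datumOfRecord₁₃CoPH F N (Stage13HParams.ofHistoryBlind F N (Stage13RParams.ofCured F N (θ.liveRepin₁₃ F N))) h) g₀ os ⟨K₀ + K, mA K, cA K⟩ (gA K) (K₀ + K) t s)
        - shA K t x)
      (fun K t x => (∑ s' ∈ Finset.univ.filter (fun s' : SeqOfRecord F θ.ν θ.τ9.M (gB K) (K₀ + K + 1) (K₀ + K + 1) =>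
          (⟨K, twoRunKeyB F θ.ν hM (gB K) (K₀ + K) (K₀ + K) s'⟩ : Σ K, SiteSeqKey F (K₀ + K)) = x),
        classWeightOfDatum₉ F N (θ.liveRepin₁₃ F N).toStage9Params
          (datumOfRecord₁₃CoPH F N (Stage13HParams.ofHistoryBlind F N (Stage13RParams.ofCured F N (θ.liveRepin₁₃ F N))) h) g₀ os ⟨K₀ + K + 1, mB K, cB K⟩ (gB K) (K₀ + K + 1) t s')
        - shB K t x) δ ∧ Summable δ) :
    ∃ δ' : ℕ → ℝ, Summable δ' ∧
      MatchingModConstants vol l₀ δ'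
        (T4GenFunBounds.schemeZ ((datumOfRecord₁₃CoPH F N (Stage13HParams.ofHistoryBlind F N (Stage13RParams.ofCured F N (θ.liveRepin₁₃ F N))) h).scheme g₀) os) :=
  matching_scheme_of_coreEdge_twoRunKeyed_liveRepin₁₃ F N θ hres hM _ (isPrintedAveraged_datumOfRecord₁₃CoPH F N _ h).avgMeasurable
    g₀ os K₀ mA mB cA cB gA gB hgA hgB hl₀ hvol h20 h21 hlt hedge

/-- **★★ N19's :183 ROAD FOR F3's CLASS WEIGHTS AT NODE U5d's COUPLING-FREE TWO-RUN SITE KEYS, AT THE STAGE-13 WITNESS OF RECORD — `hres` AND `hM` DISCHARGED, NO FLOW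
HYPOTHESIS** (`θ₁₃ = theta13LiveOfRecord F N`; basic cube size `1`, `rfl`).  DISPLAYED: `D hD g₀ os K₀ mA mB cA cB gA gB hgA hgB`, `hl₀ hvol`, THE FOUR ESTIMATES — nothing else.
[cite: Balaban1985UV3, (6) p.257; Balaban1989LargeFieldII, Thm 1 + (0.1) pp.355–356; Balaban1989LargeFieldI, (0.2)–(0.4) p.176; Balaban1988Convergent, (2.1) p.254, (2.18) p.257; King1986, (3.10) p.656 (bookkeeping)] -/
theorem matching_scheme_of_coreEdge_twoRunKeyed_theta13LiveOfRecord
    (D : FiniteEpsData F (SU N)) (hD : D.AvgMeasurable) (g₀ : ℕ → ℝ) (os : List (ULoop F)) (K₀ : ℕ) (mA mB : ℕ → ℕ) (cA cB : ℕ → ℝ) (gA gB : ℕ → ℕ → ℝ)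
    (hgA : ∀ K, gA K 0 = g₀ (K₀ + K)) (hgB : ∀ K, gB K 0 = g₀ (K₀ + K + 1))
    {l₀ vol : ℝ} (hl₀ : 0 ≤ l₀) (hvol : 0 < vol) {shA shB : ℕ → ℝ → (Σ K, SiteSeqKey F (K₀ + K)) → ℝ} {Bad : ℕ → ℝ → Finset (Σ K, SiteSeqKey F (K₀ + K))}
    {W Wsh : ℕ → ℝ}
    (h20 : RelWeightBound l₀
      (fun K => Finset.univ.image (fun s : SeqOfRecord F (theta13LiveOfRecord F N).ν (theta13LiveOfRecord F N).τ9.M (gA K) (K₀ + K) (K₀ + K) =>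
          (⟨K, twoRunKeyA F (theta13LiveOfRecord F N).ν (theta13LiveOfRecord F N).τ9.M (gA K) (K₀ + K) (K₀ + K) s⟩ : Σ K, SiteSeqKey F (K₀ + K)))
        ∪ Finset.univ.image (fun s' : SeqOfRecord F (theta13LiveOfRecord F N).ν (theta13LiveOfRecord F N).τ9.M (gB K) (K₀ + K + 1) (K₀ + K + 1) =>
          (⟨K, twoRunKeyB F (theta13LiveOfRecord F N).ν Nat.one_pos (gB K) (K₀ + K) (K₀ + K) s'⟩ : Σ K, SiteSeqKey F (K₀ + K))))
      (fun K t x => ∑ s ∈ Finset.univ.filter (fun s : SeqOfRecord F (theta13LiveOfRecord F N).ν (theta13LiveOfRecord F N).τ9.M (gA K) (K₀ + K) (K₀ + K) =>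
          (⟨K, twoRunKeyA F (theta13LiveOfRecord F N).ν (theta13LiveOfRecord F N).τ9.M (gA K) (K₀ + K) (K₀ + K) s⟩ : Σ K, SiteSeqKey F (K₀ + K)) = x),
        classWeightOfDatum₉ F N (theta13LiveOfRecord F N).toStage9Params D g₀ os ⟨K₀ + K, mA K, cA K⟩ (gA K) (K₀ + K) t s)
      (fun K t x => ∑ s' ∈ Finset.univ.filter (fun s' : SeqOfRecord F (theta13LiveOfRecord F N).ν (theta13LiveOfRecord F N).τ9.M (gB K) (K₀ + K + 1) (K₀ + K + 1) =>
          (⟨K, twoRunKeyB F (theta13LiveOfRecord F N).ν Nat.one_pos (gB K) (K₀ + K) (K₀ + K) s'⟩ : Σ K, SiteSeqKey F (K₀ + K)) = x),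
        classWeightOfDatum₉ F N (theta13LiveOfRecord F N).toStage9Params D g₀ os ⟨K₀ + K + 1, mB K, cB K⟩ (gB K) (K₀ + K + 1) t s') Bad W)
    (h21 : ShellWeightBound l₀
      (fun K => Finset.univ.image (fun s : SeqOfRecord F (theta13LiveOfRecord F N).ν (theta13LiveOfRecord F N).τ9.M (gA K) (K₀ + K) (K₀ + K) =>
          (⟨K, twoRunKeyA F (theta13LiveOfRecord F N).ν (theta13LiveOfRecord F N).τ9.M (gA K) (K₀ + K) (K₀ + K) s⟩ : Σ K, SiteSeqKey F (K₀ + K)))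
        ∪ Finset.univ.image (fun s' : SeqOfRecord F (theta13LiveOfRecord F N).ν (theta13LiveOfRecord F N).τ9.M (gB K) (K₀ + K + 1) (K₀ + K + 1) =>
          (⟨K, twoRunKeyB F (theta13LiveOfRecord F N).ν Nat.one_pos (gB K) (K₀ + K) (K₀ + K) s'⟩ : Σ K, SiteSeqKey F (K₀ + K))))
      (fun K t x => ∑ s ∈ Finset.univ.filter (fun s : SeqOfRecord F (theta13LiveOfRecord F N).ν (theta13LiveOfRecord F N).τ9.M (gA K) (K₀ + K) (K₀ + K) =>
          (⟨K, twoRunKeyA F (theta13LiveOfRecord F N).ν (theta13LiveOfRecord F N).τ9.M (gA K) (K₀ + K) (K₀ + K) s⟩ : Σ K, SiteSeqKey F (K₀ + K)) = x),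
        classWeightOfDatum₉ F N (theta13LiveOfRecord F N).toStage9Params D g₀ os ⟨K₀ + K, mA K, cA K⟩ (gA K) (K₀ + K) t s)
      (fun K t x => ∑ s' ∈ Finset.univ.filter (fun s' : SeqOfRecord F (theta13LiveOfRecord F N).ν (theta13LiveOfRecord F N).τ9.M (gB K) (K₀ + K + 1) (K₀ + K + 1) =>
          (⟨K, twoRunKeyB F (theta13LiveOfRecord F N).ν Nat.one_pos (gB K) (K₀ + K) (K₀ + K) s'⟩ : Σ K, SiteSeqKey F (K₀ + K)) = x),
        classWeightOfDatum₉ F N (theta13LiveOfRecord F N).toStage9Params D g₀ os ⟨K₀ + K + 1, mB K, cB K⟩ (gB K) (K₀ + K + 1) t s') shA shB Wsh)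
    (hlt : ∀ K, W K + Wsh K < 1)
    (hedge : ∃ δ : ℕ → ℝ, NE7.Core l₀ vol
      (fun K => Finset.univ.image (fun s : SeqOfRecord F (theta13LiveOfRecord F N).ν (theta13LiveOfRecord F N).τ9.M (gA K) (K₀ + K) (K₀ + K) =>
          (⟨K, twoRunKeyA F (theta13LiveOfRecord F N).ν (theta13LiveOfRecord F N).τ9.M (gA K) (K₀ + K) (K₀ + K) s⟩ : Σ K, SiteSeqKey F (K₀ + K)))
        ∪ Finset.univ.image (fun s' : SeqOfRecord F (theta13LiveOfRecord F N).ν (theta13LiveOfRecord F N).τ9.M (gB K) (K₀ + K + 1) (K₀ + K + 1) =>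
          (⟨K, twoRunKeyB F (theta13LiveOfRecord F N).ν Nat.one_pos (gB K) (K₀ + K) (K₀ + K) s'⟩ : Σ K, SiteSeqKey F (K₀ + K)))) Bad
      (fun K t x => (∑ s ∈ Finset.univ.filter (fun s : SeqOfRecord F (theta13LiveOfRecord F N).ν (theta13LiveOfRecord F N).τ9.M (gA K) (K₀ + K) (K₀ + K) =>
          (⟨K, twoRunKeyA F (theta13LiveOfRecord F N).ν (theta13LiveOfRecord F N).τ9.M (gA K) (K₀ + K) (K₀ + K) s⟩ : Σ K, SiteSeqKey F (K₀ + K)) = x),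
        classWeightOfDatum₉ F N (theta13LiveOfRecord F N).toStage9Params D g₀ os ⟨K₀ + K, mA K, cA K⟩ (gA K) (K₀ + K) t s) - shA K t x)
      (fun K t x => (∑ s' ∈ Finset.univ.filter (fun s' : SeqOfRecord F (theta13LiveOfRecord F N).ν (theta13LiveOfRecord F N).τ9.M (gB K) (K₀ + K + 1) (K₀ + K + 1) =>
          (⟨K, twoRunKeyB F (theta13LiveOfRecord F N).ν Nat.one_pos (gB K) (K₀ + K) (K₀ + K) s'⟩ : Σ K, SiteSeqKey F (K₀ + K)) = x),
        classWeightOfDatum₉ F N (theta13LiveOfRecord F N).toStage9Params D g₀ os ⟨K₀ + K + 1, mB K, cB K⟩ (gB K) (K₀ + K + 1) t s') - shB K t x)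
        δ ∧ Summable δ) :
    ∃ δ' : ℕ → ℝ, Summable δ' ∧ MatchingModConstants vol l₀ δ' (T4GenFunBounds.schemeZ (D.scheme g₀) os) :=
  matching_scheme_of_coreEdge_twoRunKeyed_liveRepin₁₃ F N (theta13OfFamily F N eps0OfRecord₁₃ _ _ _) (hasResidualsOfRecord_theta13OfFamily F N eps0OfRecord₁₃)
    Nat.one_pos D hD g₀ os K₀ mA mB cA cB gA gB hgA hgB hl₀ hvol h20 h21 hlt hedge

variable (j : ℕ) (γ ε₀ ε₂₉ B₃ B₃' a₀ a₁ : ℝ)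

/-- **★★ THE SAME AT dag-n21-c's WINDOWED COLLARED K0⁷ WITNESS `θ₁₅ᶜᶜᴹ(j; γ) = theta13OfThm1CCMW F N j γ ε₀ ε₂₉ B₃ B₃' a₀ a₁` — `hres` AND `hM` DISCHARGED** (a member of K0a's
all-numerics family, `rfl`; cube size `L^j > 0`, dag-n21-c's `τ9_M_pos_theta13OfThm1CCMW`).  DISPLAYED: bookkeeping, `hl₀ hvol`, THE FOUR ESTIMATES — no law binder, no window sign,
no `n.Pos`, no proviso, no flow hypothesis. [cite: Balaban1985UV3, (6) p.257; Balaban1989LargeFieldII, Thm 1 + (0.1) pp.355–356; Balaban1988Convergent, (2.1) p.254, (2.18) p.257; King1986, (3.10) p.656; Balaban1987RG1, Thm 1 p.255 (bookkeeping)] -/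
theorem matching_scheme_of_coreEdge_twoRunKeyed_theta13OfThm1CCMW
    (D : FiniteEpsData F (SU N)) (hD : D.AvgMeasurable) (g₀ : ℕ → ℝ) (os : List (ULoop F)) (K₀ : ℕ) (mA mB : ℕ → ℕ) (cA cB : ℕ → ℝ) (gA gB : ℕ → ℕ → ℝ)
    (hgA : ∀ K, gA K 0 = g₀ (K₀ + K)) (hgB : ∀ K, gB K 0 = g₀ (K₀ + K + 1))
    {l₀ vol : ℝ} (hl₀ : 0 ≤ l₀) (hvol : 0 < vol) {shA shB : ℕ → ℝ → (Σ K, SiteSeqKey F (K₀ + K)) → ℝ} {Bad : ℕ → ℝ → Finset (Σ K, SiteSeqKey F (K₀ + K))}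
    {W Wsh : ℕ → ℝ}
    (h20 : RelWeightBound l₀
      (fun K => Finset.univ.image (fun s : SeqOfRecord F (theta13OfThm1CCMW F N j γ ε₀ ε₂₉ B₃ B₃' a₀ a₁).ν
            (theta13OfThm1CCMW F N j γ ε₀ ε₂₉ B₃ B₃' a₀ a₁).τ9.M (gA K) (K₀ + K) (K₀ + K) =>
          (⟨K, twoRunKeyA F (theta13OfThm1CCMW F N j γ ε₀ ε₂₉ B₃ B₃' a₀ a₁).ν (theta13OfThm1CCMW F N j γ ε₀ ε₂₉ B₃ B₃' a₀ a₁).τ9.M (gA K) (K₀ + K) (K₀ + K) s⟩ :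
            Σ K, SiteSeqKey F (K₀ + K)))
        ∪ Finset.univ.image (fun s' : SeqOfRecord F (theta13OfThm1CCMW F N j γ ε₀ ε₂₉ B₃ B₃' a₀ a₁).ν
            (theta13OfThm1CCMW F N j γ ε₀ ε₂₉ B₃ B₃' a₀ a₁).τ9.M (gB K) (K₀ + K + 1) (K₀ + K + 1) =>
          (⟨K, twoRunKeyB F (theta13OfThm1CCMW F N j γ ε₀ ε₂₉ B₃ B₃' a₀ a₁).ν (τ9_M_pos_theta13OfThm1CCMW F N j γ ε₀ ε₂₉ B₃ B₃' a₀ a₁) (gB K) (K₀ + K) (K₀ + K) s'⟩ :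
            Σ K, SiteSeqKey F (K₀ + K))))
      (fun K t x => ∑ s ∈ Finset.univ.filter (fun s : SeqOfRecord F (theta13OfThm1CCMW F N j γ ε₀ ε₂₉ B₃ B₃' a₀ a₁).ν
            (theta13OfThm1CCMW F N j γ ε₀ ε₂₉ B₃ B₃' a₀ a₁).τ9.M (gA K) (K₀ + K) (K₀ + K) =>
          (⟨K, twoRunKeyA F (theta13OfThm1CCMW F N j γ ε₀ ε₂₉ B₃ B₃' a₀ a₁).ν (theta13OfThm1CCMW F N j γ ε₀ ε₂₉ B₃ B₃' a₀ a₁).τ9.M (gA K) (K₀ + K) (K₀ + K) s⟩ :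
            Σ K, SiteSeqKey F (K₀ + K)) = x),
        classWeightOfDatum₉ F N (theta13OfThm1CCMW F N j γ ε₀ ε₂₉ B₃ B₃' a₀ a₁).toStage9Params D g₀ os ⟨K₀ + K, mA K, cA K⟩ (gA K) (K₀ + K) t s)
      (fun K t x => ∑ s' ∈ Finset.univ.filter (fun s' : SeqOfRecord F (theta13OfThm1CCMW F N j γ ε₀ ε₂₉ B₃ B₃' a₀ a₁).ν
            (theta13OfThm1CCMW F N j γ ε₀ ε₂₉ B₃ B₃' a₀ a₁).τ9.M (gB K) (K₀ + K + 1) (K₀ + K + 1) =>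
          (⟨K, twoRunKeyB F (theta13OfThm1CCMW F N j γ ε₀ ε₂₉ B₃ B₃' a₀ a₁).ν (τ9_M_pos_theta13OfThm1CCMW F N j γ ε₀ ε₂₉ B₃ B₃' a₀ a₁) (gB K) (K₀ + K) (K₀ + K) s'⟩ :
            Σ K, SiteSeqKey F (K₀ + K)) = x),
        classWeightOfDatum₉ F N (theta13OfThm1CCMW F N j γ ε₀ ε₂₉ B₃ B₃' a₀ a₁).toStage9Params D g₀ os ⟨K₀ + K + 1, mB K, cB K⟩ (gB K) (K₀ + K + 1) t s') Bad W)
    (h21 : ShellWeightBound l₀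
      (fun K => Finset.univ.image (fun s : SeqOfRecord F (theta13OfThm1CCMW F N j γ ε₀ ε₂₉ B₃ B₃' a₀ a₁).ν
            (theta13OfThm1CCMW F N j γ ε₀ ε₂₉ B₃ B₃' a₀ a₁).τ9.M (gA K) (K₀ + K) (K₀ + K) =>
          (⟨K, twoRunKeyA F (theta13OfThm1CCMW F N j γ ε₀ ε₂₉ B₃ B₃' a₀ a₁).ν (theta13OfThm1CCMW F N j γ ε₀ ε₂₉ B₃ B₃' a₀ a₁).τ9.M (gA K) (K₀ + K) (K₀ + K) s⟩ :
            Σ K, SiteSeqKey F (K₀ + K)))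
        ∪ Finset.univ.image (fun s' : SeqOfRecord F (theta13OfThm1CCMW F N j γ ε₀ ε₂₉ B₃ B₃' a₀ a₁).ν
            (theta13OfThm1CCMW F N j γ ε₀ ε₂₉ B₃ B₃' a₀ a₁).τ9.M (gB K) (K₀ + K + 1) (K₀ + K + 1) =>
          (⟨K, twoRunKeyB F (theta13OfThm1CCMW F N j γ ε₀ ε₂₉ B₃ B₃' a₀ a₁).ν (τ9_M_pos_theta13OfThm1CCMW F N j γ ε₀ ε₂₉ B₃ B₃' a₀ a₁) (gB K) (K₀ + K) (K₀ + K) s'⟩ :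
            Σ K, SiteSeqKey F (K₀ + K))))
      (fun K t x => ∑ s ∈ Finset.univ.filter (fun s : SeqOfRecord F (theta13OfThm1CCMW F N j γ ε₀ ε₂₉ B₃ B₃' a₀ a₁).ν
            (theta13OfThm1CCMW F N j γ ε₀ ε₂₉ B₃ B₃' a₀ a₁).τ9.M (gA K) (K₀ + K) (K₀ + K) =>
          (⟨K, twoRunKeyA F (theta13OfThm1CCMW F N j γ ε₀ ε₂₉ B₃ B₃' a₀ a₁).ν (theta13OfThm1CCMW F N j γ ε₀ ε₂₉ B₃ B₃' a₀ a₁).τ9.M (gA K) (K₀ + K) (K₀ + K) s⟩ :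
            Σ K, SiteSeqKey F (K₀ + K)) = x),
        classWeightOfDatum₉ F N (theta13OfThm1CCMW F N j γ ε₀ ε₂₉ B₃ B₃' a₀ a₁).toStage9Params D g₀ os ⟨K₀ + K, mA K, cA K⟩ (gA K) (K₀ + K) t s)
      (fun K t x => ∑ s' ∈ Finset.univ.filter (fun s' : SeqOfRecord F (theta13OfThm1CCMW F N j γ ε₀ ε₂₉ B₃ B₃' a₀ a₁).ν
            (theta13OfThm1CCMW F N j γ ε₀ ε₂₉ B₃ B₃' a₀ a₁).τ9.M (gB K) (K₀ + K + 1) (K₀ + K + 1) =>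
          (⟨K, twoRunKeyB F (theta13OfThm1CCMW F N j γ ε₀ ε₂₉ B₃ B₃' a₀ a₁).ν (τ9_M_pos_theta13OfThm1CCMW F N j γ ε₀ ε₂₉ B₃ B₃' a₀ a₁) (gB K) (K₀ + K) (K₀ + K) s'⟩ :
            Σ K, SiteSeqKey F (K₀ + K)) = x),
        classWeightOfDatum₉ F N (theta13OfThm1CCMW F N j γ ε₀ ε₂₉ B₃ B₃' a₀ a₁).toStage9Params D g₀ os ⟨K₀ + K + 1, mB K, cB K⟩ (gB K) (K₀ + K + 1) t s')
      shA shB Wsh)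
    (hlt : ∀ K, W K + Wsh K < 1)
    (hedge : ∃ δ : ℕ → ℝ, NE7.Core l₀ vol
      (fun K => Finset.univ.image (fun s : SeqOfRecord F (theta13OfThm1CCMW F N j γ ε₀ ε₂₉ B₃ B₃' a₀ a₁).ν
            (theta13OfThm1CCMW F N j γ ε₀ ε₂₉ B₃ B₃' a₀ a₁).τ9.M (gA K) (K₀ + K) (K₀ + K) =>
          (⟨K, twoRunKeyA F (theta13OfThm1CCMW F N j γ ε₀ ε₂₉ B₃ B₃' a₀ a₁).ν (theta13OfThm1CCMW F N j γ ε₀ ε₂₉ B₃ B₃' a₀ a₁).τ9.M (gA K) (K₀ + K) (K₀ + K) s⟩ :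
            Σ K, SiteSeqKey F (K₀ + K)))
        ∪ Finset.univ.image (fun s' : SeqOfRecord F (theta13OfThm1CCMW F N j γ ε₀ ε₂₉ B₃ B₃' a₀ a₁).ν
            (theta13OfThm1CCMW F N j γ ε₀ ε₂₉ B₃ B₃' a₀ a₁).τ9.M (gB K) (K₀ + K + 1) (K₀ + K + 1) =>
          (⟨K, twoRunKeyB F (theta13OfThm1CCMW F N j γ ε₀ ε₂₉ B₃ B₃' a₀ a₁).ν (τ9_M_pos_theta13OfThm1CCMW F N j γ ε₀ ε₂₉ B₃ B₃' a₀ a₁) (gB K) (K₀ + K) (K₀ + K) s'⟩ :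
            Σ K, SiteSeqKey F (K₀ + K)))) Bad
      (fun K t x => (∑ s ∈ Finset.univ.filter (fun s : SeqOfRecord F (theta13OfThm1CCMW F N j γ ε₀ ε₂₉ B₃ B₃' a₀ a₁).ν
            (theta13OfThm1CCMW F N j γ ε₀ ε₂₉ B₃ B₃' a₀ a₁).τ9.M (gA K) (K₀ + K) (K₀ + K) =>
          (⟨K, twoRunKeyA F (theta13OfThm1CCMW F N j γ ε₀ ε₂₉ B₃ B₃' a₀ a₁).ν (theta13OfThm1CCMW F N j γ ε₀ ε₂₉ B₃ B₃' a₀ a₁).τ9.M (gA K) (K₀ + K) (K₀ + K) s⟩ :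
            Σ K, SiteSeqKey F (K₀ + K)) = x),
        classWeightOfDatum₉ F N (theta13OfThm1CCMW F N j γ ε₀ ε₂₉ B₃ B₃' a₀ a₁).toStage9Params D g₀ os ⟨K₀ + K, mA K, cA K⟩ (gA K) (K₀ + K) t s) - shA K t x)
      (fun K t x => (∑ s' ∈ Finset.univ.filter (fun s' : SeqOfRecord F (theta13OfThm1CCMW F N j γ ε₀ ε₂₉ B₃ B₃' a₀ a₁).ν
            (theta13OfThm1CCMW F N j γ ε₀ ε₂₉ B₃ B₃' a₀ a₁).τ9.M (gB K) (K₀ + K + 1) (K₀ + K + 1) =>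
          (⟨K, twoRunKeyB F (theta13OfThm1CCMW F N j γ ε₀ ε₂₉ B₃ B₃' a₀ a₁).ν (τ9_M_pos_theta13OfThm1CCMW F N j γ ε₀ ε₂₉ B₃ B₃' a₀ a₁) (gB K) (K₀ + K) (K₀ + K) s'⟩ :
            Σ K, SiteSeqKey F (K₀ + K)) = x),
        classWeightOfDatum₉ F N (theta13OfThm1CCMW F N j γ ε₀ ε₂₉ B₃ B₃' a₀ a₁).toStage9Params D g₀ os ⟨K₀ + K + 1, mB K, cB K⟩ (gB K) (K₀ + K + 1) t s') - shB K t x)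
        δ ∧ Summable δ) :
    ∃ δ' : ℕ → ℝ, Summable δ' ∧ MatchingModConstants vol l₀ δ' (T4GenFunBounds.schemeZ (D.scheme g₀) os) :=
  matching_scheme_of_coreEdge_twoRunKeyed_liveRepin₁₃ F N
    (theta13OfNumerics F N (stage12NumericsOfThm1CCMW F.L j γ ε₀ B₃ B₃' a₀ a₁) ε₂₉ _ _ _) (hasResidualsOfRecord_theta13OfNumerics F N _ ε₂₉)
    (τ9_M_pos_theta13OfThm1CCMW F N j γ ε₀ ε₂₉ B₃ B₃' a₀ a₁) D hD g₀ os K₀ mA mB cA cB gA gB hgA hgB hl₀ hvol h20 h21 hlt hedge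

end Road

end Summit.QuantumFields.YangMills.BalabanUVNodes.N19TargetClassWeightsTwoRunKeyed

end
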